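import Mathlib
import Summits.ValiantsHypothesis.ValiantsHypothesis.Theorems.BarrierLeverPartitionMinorsHitByVPHiddenStatesSecondShellNestedRows

/-!
# Route BarrierLever — item `PartitionMinorsHitByVP` (stmt-ValiantsHypothesis-19717), line `hidden-states`:
# SECOND-SHELL «SHARED-EXIT NESTED» CLASSES — the vanishing cross minor (toolkit for the fifth cancellation cell)

Helper file (`--supports stmt-ValiantsHypothesis-19717`; cell valiant-natproofs, 𝒟-side door (c), registered line
`Cruxes/PartitionMinorsHitByVP/Lines/hidden_states.lean` v8; prover seat val-np-p6 gen 17).  Closes NO item; definition-free.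

SHARED-EXIT NESTED (memo §4c): as in `…SecondShellNestedWideCross` — `C₁∖A₁ = {y_b,y_p,y_t}`, `C₂∖A₂ = {y_m,y_b,y_p}`,
`y_m ∉ A₁`, `y_t ∉ A₂ ∪ C₂` — but now the two attachments of `y_b` are `x₀ ∉ A₂ ∪ C₂` and a SHARED attachment `s ∈ (A₁∖C₁) ∩ (A₂∖C₂)`
(`A₂∖C₂ = {s, q}`, below `s = q₁`, `q = q₂`): the digraph `p→b→{x₀,s,m}, m→{s,q}`.  With `Z = A₂ ∩ C₂` the start row is the combination
`nested_budget_identity_shared` of eleven rows `Z ∪ T`, the only pure-exit pair being `{s,q}` (`Z ∪ {s,q} = A₂ ≠ A₁`), so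
`D_{B−A₁+C₂} ≡ 0`: `nestedShared_cross_det_eq_zero`.  EXACT t = 4 CENSUS (kit j321077): shape {0123,1234;12567,12568} (22 680 of the
279 720 uncovered families) — y_b,y_p,y_t = 5,6,7, x₀ = 0, s = 3, y_m = 8, q = 4.

HONEST LABEL: conjecture-column cells (second shell, every `t, h`); 19717 stays OPEN; nothing on crux 14610 or VP ≠ VNP.
-/

set_option linter.dupNamespace false

namespace Summit.ValiantsHypothesis.ValiantsHypothesis.Theorems.BarrierLever.HiddenStates

open Finset

noncomputable section

namespace SecondShell

open PathTable

/-! ## The vanishing cross minor of the shared-exit nested class -/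

/-- ★ for the shared-exit nested orientation (`x₀ ∉ A₂ ∪ C₂`, `s` attached to both bottoms, `y_t ∉ A₂ ∪ C₂`, `y_m ∉ A₁`), the
cross minor through `C₂` of ANY row family avoiding `A₁` but containing all other small sets vanishes for EVERY parameter. -/
theorem nestedShared_cross_det_eq_zero {h : ℕ} (t : ℕ) (A₁ A₂ C₁ C₂ : Finset (Fin h)) (hA₁ : A₁.card = t)
    (hC₂ : C₂.card = t + 1) (hA : A₁ ≠ A₂) {ym yb yp yt x₀ q₁ q₂ : Fin h}
    (hY₁ : C₁ \ A₁ = {yb, yp, yt}) (hbp : yb ≠ yp)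
    (hx₀ : x₀ ∈ A₁ \ C₁)
    (hY₂ : C₂ \ A₂ = {ym, yb, yp}) (hmb : ym ≠ yb) (hmp : ym ≠ yp) (hX₂ : A₂ \ C₂ = {q₁, q₂}) (hq : q₁ ≠ q₂)
    (hm : ym ∉ A₁) (htA : yt ∉ A₂) (htC : yt ∉ C₂) (hx₀C : x₀ ∉ C₂) (hx₀A : x₀ ∉ A₂)
    {j₁ j₁' j₂ j₂' : ℕ} (e₁ : (Fin (2 + 1) ⊕ Fin 2) ⊕ (Fin j₁ ⊕ Fin j₁') ≃ Fin h)
    (e₂ : (Fin (2 + 1) ⊕ Fin 2) ⊕ (Fin j₂ ⊕ Fin j₂') ≃ Fin h)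
    (m1 : ∀ x, e₁ (Sum.inl (Sum.inl x)) ∈ C₁ \ A₁) (n1 : ∀ x, e₂ (Sum.inl (Sum.inl x)) ∈ C₂ \ A₂)
    (hbot₁ : e₁ (Sum.inl (Sum.inl 0)) = yb) (hmid₁ : e₁ (Sum.inl (Sum.inl 1)) = yp)
    {i₀ i₀' : Fin 2} (hii₁ : i₀ ≠ i₀')
    (hatt₁ : e₁ (Sum.inl (Sum.inr i₀)) = x₀) (hatt₁1 : e₁ (Sum.inl (Sum.inr i₀')) = q₁)
    (hbot₂ : e₂ (Sum.inl (Sum.inl 0)) = ym) (hmid₂ : e₂ (Sum.inl (Sum.inl 1)) = yb)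
    (htop₂ : e₂ (Sum.inl (Sum.inl (Fin.last 2))) = yp) {l₀ l₀' : Fin 2} (hll : l₀ ≠ l₀')
    (hatt₂ : e₂ (Sum.inl (Sum.inr l₀)) = q₁) (hatt₂1 : e₂ (Sum.inl (Sum.inr l₀')) = q₂)
    {r : ℕ} (rows cols : Fin r → Finset (Fin h)) (i₁ : Fin r) (hrow : rows i₁ = C₂)
    (key : ∀ S : Finset (Fin h), S.card ≤ t → S ≠ A₁ → ∃ i, i ≠ i₁ ∧ rows i = S)
    (hcolcard : ∀ kk, (cols kk).card ≤ t) :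
    ∀ ε, (mat (tab2 (fun a q => swapTable' e₁ a q - if q = a then 1 else 0)
      (fun a q => swapTable' e₂ a q - if q = a then 1 else 0) ε) rows cols).det = 0 := by
  classical
  set N₁ : Fin h → Fin h → ℂ := fun a q => swapTable' e₁ a q - if q = a then 1 else 0 with hN₁
  set N₂ : Fin h → Fin h → ℂ := fun a q => swapTable' e₂ a q - if q = a then 1 else 0 with hN₂
  have hY₂c : (C₂ \ A₂).card = 3 := by
    rw [hY₂, Finset.card_insert_of_notMem (by simp [hmb, hmp]), Finset.card_pair hbp]
  set Z : Finset (Fin h) := A₂ ∩ C₂ with hZdef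
  have hZc : Z.card + 3 = t + 1 := by
    have h1 : (C₂ \ A₂).card + (C₂ ∩ A₂).card = C₂.card := Finset.card_sdiff_add_card_inter C₂ A₂
    have h2 : C₂ ∩ A₂ = Z := Finset.inter_comm C₂ A₂
    rw [hY₂c, hC₂, h2] at h1
    omega
  -- membership facts
  have hyb₁ : yb ∈ C₁ \ A₁ := by rw [hY₁]; simp
  have hym₂ : ym ∈ C₂ \ A₂ := by rw [hY₂]; simp
  have hyb₂ : yb ∈ C₂ \ A₂ := by rw [hY₂]; simp
  have hyp₂ : yp ∈ C₂ \ A₂ := by rw [hY₂]; simp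
  have hq₁ : q₁ ∈ A₂ \ C₂ := by rw [hX₂]; simp
  have hq₂ : q₂ ∈ A₂ \ C₂ := by rw [hX₂]; simp
  obtain ⟨⟨hymC, hymA⟩, ⟨hybC, hybA⟩, ⟨hypC, hypA⟩⟩ :=
    And.intro (Finset.mem_sdiff.1 hym₂) (And.intro (Finset.mem_sdiff.1 hyb₂) (Finset.mem_sdiff.1 hyp₂))
  obtain ⟨⟨hq₁A, hq₁C⟩, ⟨hq₂A, hq₂C⟩⟩ := And.intro (Finset.mem_sdiff.1 hq₁) (Finset.mem_sdiff.1 hq₂)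
  have hx₀C₁ : x₀ ∉ C₁ := (Finset.mem_sdiff.1 hx₀).2
  have hybA₁ : yb ∉ A₁ := (Finset.mem_sdiff.1 hyb₁).2
  have hypA₁ : yp ∉ A₁ := by
    have : yp ∈ C₁ \ A₁ := by rw [hY₁]; simp
    exact (Finset.mem_sdiff.1 this).2
  -- distinctness
  have nmx : ym ≠ x₀ := fun h' => hx₀C (h' ▸ hymC)
  have nmq₁ : ym ≠ q₁ := fun h' => hq₁C (h' ▸ hymC)
  have nmq₂ : ym ≠ q₂ := fun h' => hq₂C (h' ▸ hymC)
  have nbx : yb ≠ x₀ := fun h' => hx₀C (h' ▸ hybC)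
  have nbq₁ : yb ≠ q₁ := fun h' => hq₁C (h' ▸ hybC)
  have nbq₂ : yb ≠ q₂ := fun h' => hq₂C (h' ▸ hybC)
  have npx : yp ≠ x₀ := fun h' => hx₀C (h' ▸ hypC)
  have npq₁ : yp ≠ q₁ := fun h' => hq₁C (h' ▸ hypC)
  have npq₂ : yp ≠ q₂ := fun h' => hq₂C (h' ▸ hypC)
  have nxq₁ : x₀ ≠ q₁ := fun h' => hx₀A (h' ▸ hq₁A)
  have nxq₂ : x₀ ≠ q₂ := fun h' => hx₀A (h' ▸ hq₂A)
  have nmt : ym ≠ yt := fun h' => htC (h' ▸ hymC)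
  have ntq₁ : yt ≠ q₁ := fun h' => htA (h' ▸ hq₁A)
  have ntq₂ : yt ≠ q₂ := fun h' => htA (h' ▸ hq₂A)
  -- non-membership in `Z`
  have hmZ : ym ∉ Z := fun h' => hymA (Finset.mem_inter.1 h').1
  have hbZ : yb ∉ Z := fun h' => hybA (Finset.mem_inter.1 h').1
  have hpZ : yp ∉ Z := fun h' => hypA (Finset.mem_inter.1 h').1
  have hxZ : x₀ ∉ Z := fun h' => hx₀C (Finset.mem_inter.1 h').2
  have hq₁Z : q₁ ∉ Z := fun h' => hq₁C (Finset.mem_inter.1 h').2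
  have hq₂Z : q₂ ∉ Z := fun h' => hq₂C (Finset.mem_inter.1 h').2
  -- decompositions
  have hC₂eq : C₂ = insert ym (insert yb (insert yp Z)) := eq_insert₃_inter hY₂
  have hA₂eq : A₂ = insert q₁ (insert q₂ Z) := eq_insert₂_inter hX₂
  -- sizes of the relation rows
  have hins2 : ∀ a a' : Fin h, (insert a (insert a' Z)).card ≤ t := fun a a' => by
    have := Finset.card_insert_le a (insert a' Z); have := Finset.card_insert_le a' Z; omega
  have hins1 : ∀ a : Fin h, (insert a Z).card ≤ t := fun a => by
    have := Finset.card_insert_le a Z; omega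
  have hneA₁_of : ∀ (a : Fin h) (S : Finset (Fin h)), a ∉ A₁ → insert a S ≠ A₁ :=
    fun a S ha h' => ha (h' ▸ Finset.mem_insert_self a S)
  have hneA₁_1 : ∀ a : Fin h, insert a Z ≠ A₁ := fun a h' => by
    have h1 := Finset.card_insert_le a Z; rw [h', hA₁] at h1; omega
  have hA₂' : insert q₁ (insert q₂ Z) ≠ A₁ := fun h' => hA (h'.symm.trans hA₂eq.symm)
  intro ε
  set w : Fin h → Fin h → ℂ := tab2 N₁ N₂ ε with hw
  -- closed forms of the table rows
  have hr1b : ∀ q, swapTable' e₁ yb q =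
      (if q = yb then 1 else 0) + (if q = x₀ then 1 else 0) + (if q = q₁ then 1 else 0) := by
    intro q
    have := row₂_bot e₁ i₀ i₀' hii₁ q
    rwa [hbot₁, hatt₁, hatt₁1] at this
  have hr1p : ∀ q, swapTable' e₁ yp q = (if q = yp then 1 else 0) + (if q = yb then 1 else 0) := by
    intro q; have := row₂_mid e₁ q; rwa [hmid₁, hbot₁] at this
  have hr2m : ∀ q, swapTable' e₂ ym q =
      (if q = ym then 1 else 0) + (if q = q₁ then 1 else 0) + (if q = q₂ then 1 else 0) := by
    intro q
    have := row₂_bot e₂ l₀ l₀' hll q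
    rwa [hbot₂, hatt₂, hatt₂1] at this
  have hr2b : ∀ q, swapTable' e₂ yb q = (if q = yb then 1 else 0) + (if q = ym then 1 else 0) := by
    intro q; have := row₂_mid e₂ q; rwa [hmid₂, hbot₂] at this
  have hr2p : ∀ q, swapTable' e₂ yp q = (if q = yp then 1 else 0) + (if q = yb then 1 else 0) := by
    intro q; have := row₂_top e₂ q; rwa [htop₂, hmid₂] at this
  have hr1u : ∀ a, a ∉ C₁ \ A₁ → ∀ q, swapTable' e₁ a q = if q = a then 1 else 0 :=
    fun a ha => row_unit A₁ C₁ e₁ m1 ha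
  have hr2u : ∀ a, a ∉ C₂ \ A₂ → ∀ q, swapTable' e₂ a q = if q = a then 1 else 0 :=
    fun a ha => row_unit A₂ C₂ e₂ n1 ha
  have hm₁ : ym ∉ C₁ \ A₁ := by rw [hY₁]; simp [hmb, hmp, nmt]
  -- pointwise table entries
  have hwm : ∀ q, w ym q = (if q = ym then 1 else 0) + ε 1 * ((if q = q₁ then 1 else 0) + (if q = q₂ then 1 else 0)) := by
    intro q; simp only [hw, tab2, hN₁, hN₂, hr1u ym hm₁ q, hr2m q]; ring
  have hwb : ∀ q, w yb q = (if q = yb then 1 else 0) + ε 0 * ((if q = x₀ then 1 else 0) + (if q = q₁ then 1 else 0))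
      + ε 1 * (if q = ym then 1 else 0) := by
    intro q; simp only [hw, tab2, hN₁, hN₂, hr1b q, hr2b q]; ring
  have hwp : ∀ q, w yp q = (if q = yp then 1 else 0) + (ε 0 + ε 1) * (if q = yb then 1 else 0) := by
    intro q; simp only [hw, tab2, hN₁, hN₂, hr1p q, hr2p q]; ring
  have hwu : ∀ a, a ∉ C₁ \ A₁ → a ∉ C₂ \ A₂ → ∀ q, w a q = if q = a then 1 else 0 := by
    intro a h1 h2 q; simp only [hw, tab2, hN₁, hN₂, hr1u a h1 q, hr2u a h2 q]; ring
  apply det_mat_eq_zero_of_rel w (rows) cols i₁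
    ![-((ε 0 + ε 1) * ε 1), (ε 0 + ε 1) * (ε 1) ^ 2 * (1 + ε 1), (ε 0 + ε 1) * (ε 1) ^ 2 * (1 + ε 1), ε 0 + ε 1, ε 1,
      -((ε 0 + ε 1) * (ε 1) ^ 2), -((ε 0 + ε 1) * ((ε 1) ^ 2 + ε 0)), -(ε 0 * (ε 0 + ε 1)), -(ε 1) ^ 2, ε 1 * (ε 0 - ε 1),
      2 * (ε 0 + ε 1) * (ε 1) ^ 3]
    ![insert ym Z, insert q₂ Z, insert q₁ Z, insert yb (insert ym Z), insert ym (insert yp Z), insert ym (insert q₂ Z),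
      insert ym (insert q₁ Z), insert ym (insert x₀ Z), insert yp (insert q₂ Z), insert yp (insert q₁ Z), insert q₁ (insert q₂ Z)]
  · intro l
    fin_cases l
    · exact key _ (hins1 ym) (hneA₁_1 ym)
    · exact key _ (hins1 q₂) (hneA₁_1 q₂)
    · exact key _ (hins1 q₁) (hneA₁_1 q₁)
    · exact key _ (hins2 yb ym) (hneA₁_of yb _ hybA₁)
    · exact key _ (hins2 ym yp) (hneA₁_of ym _ hm)
    · exact key _ (hins2 ym q₂) (hneA₁_of ym _ hm)
    · exact key _ (hins2 ym q₁) (hneA₁_of ym _ hm)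
    · exact key _ (hins2 ym x₀) (hneA₁_of ym _ hm)
    · exact key _ (hins2 yp q₂) (hneA₁_of yp _ hypA₁)
    · exact key _ (hins2 yp q₁) (hneA₁_of yp _ hypA₁)
    · exact key _ (hins2 q₁ q₂) hA₂'
  · intro kk
    rw [hrow]
    simp only [Fin.sum_univ_succ, Fin.sum_univ_zero, Matrix.cons_val_zero, Matrix.cons_val_succ, add_zero]
    set J := cols kk with hJ
    set Y : Fin h → ℂ := fun a => ∑ q ∈ J, w a q with hY
    set Φ : ℂ := ∏ a ∈ Z, Y a with hΦ
    have hP2 : ∀ a a' : Fin h, a ≠ a' → a ∉ Z → a' ∉ Z →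
        ∏ x ∈ insert a (insert a' Z), Y x = Y a * (Y a' * Φ) := by
      intro a a' h1 h2 h3
      rw [Finset.prod_insert (by simp only [Finset.mem_insert, not_or]; exact ⟨h1, h2⟩), Finset.prod_insert h3]
    have hP1 : ∀ a : Fin h, a ∉ Z → ∏ x ∈ insert a Z, Y x = Y a * Φ := by
      intro a h2; rw [Finset.prod_insert h2]
    have hP3 : ∏ x ∈ C₂, Y x = Y ym * (Y yb * (Y yp * Φ)) := by
      rw [hC₂eq, Finset.prod_insert (by simp only [Finset.mem_insert, not_or]; exact ⟨hmb, hmp, hmZ⟩),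
        Finset.prod_insert (by simp only [Finset.mem_insert, not_or]; exact ⟨hbp, hbZ⟩), Finset.prod_insert hpZ]
    rw [hP3, hP1 ym hmZ, hP1 q₂ hq₂Z, hP1 q₁ hq₁Z, hP2 yb ym hmb.symm hbZ hmZ, hP2 ym yp hmp hmZ hpZ,
      hP2 ym q₂ nmq₂ hmZ hq₂Z, hP2 ym q₁ nmq₁ hmZ hq₁Z, hP2 ym x₀ nmx hmZ hxZ, hP2 yp q₂ npq₂ hpZ hq₂Z,
      hP2 yp q₁ npq₁ hpZ hq₁Z, hP2 q₁ q₂ hq hq₁Z hq₂Z]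
    -- the indicators
    set nm : ℕ := if ym ∈ J then 1 else 0 with hnm
    set nb : ℕ := if yb ∈ J then 1 else 0 with hnb
    set np : ℕ := if yp ∈ J then 1 else 0 with hnp
    set nx : ℕ := if x₀ ∈ J then 1 else 0 with hnx
    set nu : ℕ := if q₁ ∈ J then 1 else 0 with hnu
    set nv : ℕ := if q₂ ∈ J then 1 else 0 with hnv
    have hI : ∀ (a : Fin h), (∑ q ∈ J, (if q = a then (1 : ℂ) else 0)) = ((if a ∈ J then 1 else 0 : ℕ) : ℂ) := by
      intro a; rw [Finset.sum_ite_eq']; split_ifs <;> simp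
    have hYm : Y ym = (nm : ℂ) + ε 1 * ((nu : ℂ) + (nv : ℂ)) := by
      simp only [hY, hnm, hnu, hnv]
      rw [Finset.sum_congr rfl (fun q _ => hwm q), Finset.sum_add_distrib, ← Finset.mul_sum,
        Finset.sum_add_distrib, hI, hI, hI]
    have hYb : Y yb = (nb : ℂ) + ε 0 * ((nx : ℂ) + (nu : ℂ)) + ε 1 * (nm : ℂ) := by
      simp only [hY, hnb, hnx, hnu, hnm]
      rw [Finset.sum_congr rfl (fun q _ => hwb q), Finset.sum_add_distrib, Finset.sum_add_distrib, ← Finset.mul_sum,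
        ← Finset.mul_sum, Finset.sum_add_distrib, hI, hI, hI, hI]
    have hYp : Y yp = (np : ℂ) + (ε 0 + ε 1) * (nb : ℂ) := by
      simp only [hY, hnp, hnb]
      rw [Finset.sum_congr rfl (fun q _ => hwp q), Finset.sum_add_distrib, ← Finset.mul_sum, hI, hI]
    have hYu : ∀ a, a ∉ C₁ \ A₁ → a ∉ C₂ \ A₂ → Y a = ((if a ∈ J then 1 else 0 : ℕ) : ℂ) := by
      intro a h1 h2
      simp only [hY]
      rw [Finset.sum_congr rfl (fun q _ => hwu a h1 h2 q), hI]
    have hx' : x₀ ∉ C₁ \ A₁ := fun h' => hx₀C₁ (Finset.mem_sdiff.1 h').1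
    have hx'' : x₀ ∉ C₂ \ A₂ := fun h' => hx₀C (Finset.mem_sdiff.1 h').1
    have hq₁' : q₁ ∉ C₁ \ A₁ := by rw [hY₁]; simp [nbq₁.symm, npq₁.symm, ntq₁.symm]
    have hq₂' : q₂ ∉ C₁ \ A₁ := by rw [hY₁]; simp [nbq₂.symm, npq₂.symm, ntq₂.symm]
    have hq₁'' : q₁ ∉ C₂ \ A₂ := fun h' => hq₁C (Finset.mem_sdiff.1 h').1
    have hq₂'' : q₂ ∉ C₂ \ A₂ := fun h' => hq₂C (Finset.mem_sdiff.1 h').1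
    have hYx : Y x₀ = (nx : ℂ) := by rw [hYu x₀ hx' hx'', hnx]
    have hYq₁ : Y q₁ = (nu : ℂ) := by rw [hYu q₁ hq₁' hq₁'', hnu]
    have hYq₂ : Y q₂ = (nv : ℂ) := by rw [hYu q₂ hq₂' hq₂'', hnv]
    rw [hYx, hYq₁, hYq₂]
    -- trivial if some inert token of `Z` is outside `J`
    rcases eq_or_ne Φ 0 with h0 | h0
    · rw [h0]; ring
    -- otherwise `Z ⊆ J`, and at most two of the six free nodes are in `J`
    have hZu : ∀ a ∈ Z, a ∉ C₁ \ A₁ ∧ a ∉ C₂ \ A₂ := by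
      intro a ha
      have ha' := Finset.mem_inter.1 ha
      refine ⟨?_, fun h' => (Finset.mem_sdiff.1 h').2 ha'.1⟩
      rw [hY₁]; simp only [Finset.mem_insert, Finset.mem_singleton, not_or]
      refine ⟨?_, ?_, ?_⟩
      · rintro rfl; exact hbZ ha
      · rintro rfl; exact hpZ ha
      · rintro rfl; exact htC ha'.2
    have hZJ : Z ⊆ J := by
      intro a ha
      by_contra haJ
      apply h0
      apply Finset.prod_eq_zero ha
      rw [hYu a (hZu a ha).1 (hZu a ha).2, if_neg haJ, Nat.cast_zero]
    have hle : nm + nb + np + nx + nu + nv ≤ 2 := by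
      have hsub : (({ym, yb, yp, x₀, q₁, q₂} : Finset (Fin h)).filter (· ∈ J)) ⊆ J \ Z := by
        intro a ha
        rw [Finset.mem_filter] at ha
        simp only [Finset.mem_insert, Finset.mem_singleton] at ha
        refine Finset.mem_sdiff.2 ⟨ha.2, ?_⟩
        rcases ha.1 with rfl | rfl | rfl | rfl | rfl | rfl
        · exact hmZ
        · exact hbZ
        · exact hpZ
        · exact hxZ
        · exact hq₁Z
        · exact hq₂Z
      have hcard := Finset.card_le_card hsub
      rw [Finset.card_sdiff_of_subset hZJ, Finset.card_filter] at hcard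
      rw [Finset.sum_insert (by simp [hmb, hmp, nmx, nmq₁, nmq₂]), Finset.sum_insert (by simp [hbp, nbx, nbq₁, nbq₂]),
        Finset.sum_insert (by simp [npx, npq₁, npq₂]), Finset.sum_insert (by simp [nxq₁, nxq₂]),
        Finset.sum_pair hq] at hcard
      have hJc : J.card ≤ t := hcolcard kk
      simp only [hnm, hnb, hnp, hnx, hnu, hnv]
      omega
    have h01 : ∀ (P : Prop) [Decidable P], (if P then 1 else 0 : ℕ) = 0 ∨ (if P then 1 else 0 : ℕ) = 1 := by
      intro P _; by_cases hP : P
      · exact Or.inr (if_pos hP)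
      · exact Or.inl (if_neg hP)
    have hid := nested_budget_identity_shared (ε 0) (ε 1) nm nb np nx nu nv (h01 _) (h01 _) (h01 _) (h01 _) (h01 _) (h01 _)
      hle (Y ym) (Y yb) (Y yp) hYm hYb hYp
    linear_combination Φ * hid

end SecondShell

end

end Summit.ValiantsHypothesis.ValiantsHypothesis.Theorems.BarrierLever.HiddenStates
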